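import Literature.MathematicalPhysics.QuantumFieldTheory.Balaban1983to89.T4OutputRate
import Summits.QuantumFields.BalabanUV.T4Continuum.Spine.NE5.TwoRunTorusNE5
import Summits.QuantumFields.BalabanUV.T4Continuum.Spine.NE5.TwoRunTorusRate

/-!
# BalabanUVNodes ∕ N18 knit — node N18 = spine estimate NE5 (`T4OutputRate.NE5`) BY NAME at the torus carriers of
# record, in the K4 family shape and in the RATE CURRENCY of its in-edges (Track A, DAG node N18; cluster K4 «SpineRates»)

HONEST FRAMING.  Count-neutral kernel bookkeeping over LANDED hypothesis shapes; NOT a node discharge (YM-PLAN §1: no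
NODE 00 stage pins node U3's carriers yet; NODE O's one-step records are instance 0∕1).  NE5 is NOT IN PRINT and NOT
PROVED: print has only the UNIFORMITY of the (0.25) bound in the lattice spacing ([Balaban1987RG1] Thm 1 p. 259 *"the
above bound is uniform in the lattice spacing ε"*); the printed MODEL of the mechanism is [King1986] Thm 3.4 p. 656 and
p. 665 *"the error is the same graph with a difference of propagators on one line … Proposition 3.8 gives the desired
factor L^{−γk}"*.  One finite four-torus programme at fixed ε; nothing continuum ∕ ℝ⁴ ∕ OS ∕ mass-gap ∕ Clay.  0 `sorry`,
0 `def`, standard axioms.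

THE NODE.  Statement of record `Literature.….T4OutputRate.NE5 EA EB W κ θ C₅` (T4OutputRate.lean :211): for every
admissible coupling sequence, run-B background and localization domain `X` born at scale `j`,
`|E^A(transport U)(X) − E^B(U)(X)| ≤ C₅·θ^j·e^{−κ d_j(X)}`.  Cluster K4's reading (dagwriter g75∕g76 supply
`BalabanUVNodesSpineRates`, `N18At u`): the estimate is asked for EVERY MEMBER `b ∈ ]0, γ]` of run B's first-coupling
family, `∀ b, 0 < b → b ≤ γ → NE5 EA (EB b) W κ θ C₅` — the shape this file concludes (§3), at the torus carriers of
record of the NE5 cell chain, `Spine.NE5.TwoRunTorusNE5.torusCarriers N W` with the real read-outs `reFunctional`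
(the carriers on which the END of row NE5, `TwoRunTorusNE5Final8.ne5_end_final_all8`, concludes `NE5` by name).

IN-EDGES OF N18 AND WHERE THEY ENTER (YM-PLAN v0.12.15 §2c row NE5; BALABAN-GAPS v1.0 §C row NE5; `ne/NE5-JUNCTION.md` v2.1):
* N10 ∕ NODE A (the [II] cluster outputs and Lemma 3 (2.38)∕(2.41) p. 20–21 re-run on the class): each run's OWN one-run
  envelope `‖E_j(X)(φ)‖ ≤ A·e^{−κ′ d_j(X)}` on the space — binders `hA1`, `hB1` below (printed: [Balaban1988RG2Cluster]
  (2.41) p. 21, per run; `A = A₂C₃ε₁`, `κ′ = (1 − 10δ)½Lκ` in the END's letters);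
* NODE O ∕ W1 (Bałaban's one-step objects of BOTH runs joined along the two-run pencil; instance 0∕1): per member `b`,
  per WINDOW scale and per domain, the holomorphic output pencil of radius `s₀ ∕ r_j` with the same envelope along it —
  binder `hpencil` of §3b (its Schwarz consequence is binder `hE` of §3a); in the END these pencils are PRODUCED from the
  per-term walk records (T25–T48 of the NE5 chain), here they are the interface;
* N15 ∕ N16 (rows NE2 ∕ NE3, the PRIMITIVE two-run rate — King's «difference of propagators on one line»): the rate
  letters `r_j` with `r_j ≤ C₂·θ^j` — binder `hrate`; by T42 `TwoRunPencilDiagonal.termWalkData_pencil_diag` a producer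
  whose two runs' walk terms are `r_j`-close owns pencil records of radius `s₀ ∕ r_j` (`s₀` = the Neumann reach), which
  is why the pencil radius is typed in THIS currency; §2 is the one scalar inequality that composes T42 into the END
  (`max 2 (s∕θ^j)·C_R ≤ s₀∕r_j` at the window scales for `s = s₀∕(2C₂C_R)`, the junction card's item 7);
* NODE 00: the carriers (`torusCarriers N W`: the scale-indexed torus models `W j : TwoTorusStep 4 L (N j)`).
WHAT HAS NO TREE PRODUCER (reported to dag-lead for n18-b): the pencils ∕ records of NODE O for Bałaban's actual (2.14)-term
kernels, and the rate `r_j ≤ C₂θ^j` of rows NE2∕NE3 in walk-weighted currency; everything else of the END is kernel.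

CONTENTS.  §1 `ne5_mono` — the node statement is monotone in its letters (window, decay, rate, constant): what a record
predicate needs to match the END's letters `((1−10δ)½Lκ, θ, 2A₂C₃ε₁∕s)` to pinned ones.  §2 `window_radius_le_reach` —
the junction inequality.  §3a `ne5_family_of_primitive_rate` — the K4 family shape at the torus carriers from the
one-run envelopes + per-member two-run bounds at pencil radius `s₀∕r_j` at the window scales `θ^j < s₀∕C₂`, with the
INHERITED rate `θ` and constant `C₅ = 2AC₂∕s₀`; §3b `ne5_family_of_primitive_rate_pencils` — the same from the
holomorphic pencils themselves (T14's Schwarz step `TwoRunTorusRate.norm_sub_le_of_pencil` inside).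

Sources: T. Bałaban, CMP **109** (1987) [Balaban1987RG1] (0.24)–(0.25) p. 257, Thm 1 p. 259, (1.18) p. 263; CMP **116**
(1988) [Balaban1988RG2Cluster] (2.38) p. 20, (2.41) p. 21; C. King, CMP **102** (1986) [King1986] Thm 3.4 (3.9) p. 656,
p. 665.  Nothing here is a claim about the Yang–Mills mass gap.
-/

noncomputable section

namespace Summit.QuantumFields.YangMills.BalabanUVNodes.N18Knit

open Metric Set
open Literature.MathematicalPhysics.QuantumFieldTheory.Balaban1983to89
open Literature.MathematicalPhysics.QuantumFieldTheory.Balaban1983to89.T4OutputRate (Carriers Functional NE5)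
open Literature.MathematicalPhysics.QuantumFieldTheory.Balaban1983to89.TreeLengthTorus (TDom tsys)
open Literature.MathematicalPhysics.QuantumFieldTheory.Balaban1983to89.B13Lemma3Torus (TwoTorusStep)
open Summit.QuantumFields.BalabanUV.T4Continuum.Spine.NE5.TwoRunTorusRate (norm_sub_le_of_pencil)
open Summit.QuantumFields.BalabanUV.T4Continuum.Spine.NE5.TwoRunTorusNE5
  (torusCarriers reFunctional ne5_of_torus_rates_all_scales)

/-! ## §1 The node statement is monotone in its letters -/

/-- **`NE5` is monotone in its letters**: a smaller window, a smaller decay rate, a larger rate `θ′ ≥ θ ≥ 0` and a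
larger constant `C₅′ ≥ C₅ ≥ 0` preserve the estimate (tree lengths are nonnegative, `Carriers.d_nonneg`).  The
bookkeeping by which pinned letters of a record are matched to the letters an END delivers. [folklore] -/
theorem ne5_mono {C : Carriers} {EA : Functional C C.BgA} {EB : Functional C C.BgB} {W W' : Set (ℕ → ℝ)}
    {κ κ' θ θ' C₅ C₅' : ℝ} (h : NE5 EA EB W κ θ C₅) (hW : W' ⊆ W) (hκ : κ' ≤ κ) (hθ : 0 ≤ θ) (hθ' : θ ≤ θ')
    (hC₅ : 0 ≤ C₅) (hC : C₅ ≤ C₅') : NE5 EA EB W' κ' θ' C₅' := by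
  intro g hg U X
  have h0 := h g (hW hg) U X
  have h1 : θ ^ C.scale X ≤ θ' ^ C.scale X := pow_le_pow_left₀ hθ hθ' _
  have h2 : Real.exp (-(κ * C.d X)) ≤ Real.exp (-(κ' * C.d X)) :=
    Real.exp_le_exp.2 (by nlinarith [C.d_nonneg X])
  calc |EA g (C.transport U) X - EB g U X| ≤ C₅ * θ ^ C.scale X * Real.exp (-(κ * C.d X)) := h0
    _ ≤ C₅' * θ' ^ C.scale X * Real.exp (-(κ' * C.d X)) :=
        mul_le_mul (mul_le_mul hC h1 (pow_nonneg hθ _) (hC₅.trans hC)) h2 (Real.exp_pos _).le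
          (mul_nonneg (hC₅.trans hC) (pow_nonneg (hθ.trans hθ') _))

/-- The K4 family shape is likewise monotone in the window of run B's first coupling: a smaller `γ′ ≤ γ` keeps it.
[folklore] -/
theorem ne5_family_mono_gamma {C : Carriers} {EA : Functional C C.BgA} {EB : ℝ → Functional C C.BgB}
    {W : Set (ℕ → ℝ)} {κ θ C₅ γ γ' : ℝ} (h : ∀ b : ℝ, 0 < b → b ≤ γ → NE5 EA (EB b) W κ θ C₅) (hγ : γ' ≤ γ) :
    ∀ b : ℝ, 0 < b → b ≤ γ' → NE5 EA (EB b) W κ θ C₅ :=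
  fun b hb hbγ => h b hb (hbγ.trans hγ)

/-! ## §2 The junction inequality (rows NE2∕NE3's rate meets the END's window radius) -/

/-- **THE JUNCTION INEQUALITY.**  With the primitive two-run rate `r ≤ C₂θ^j` of rows NE2∕NE3, the Neumann reach `s₀` of
T42 `TwoRunPencilDiagonal.termWalkData_pencil_diag` (pencil records of radius `≤ s₀∕r`) and the END's size constant
`C_R` (`TwoRunTorusNE5Final8.ne5_end_final_all8` asks records of radius `max 2 (s∕θ^j)·C_R` at the window scales
`θ^j < s`), the choice `s := s₀∕(2C₂C_R)` makes the END's radius fit inside T42's reach at every window scale: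
`max 2 (s∕θ^j)·C_R ≤ s₀∕r`.  (`ne/NE5-JUNCTION.md` v2.1 item 7 in kernel form.) [folklore] -/
theorem window_radius_le_reach {θ s₀ C₂ CR r : ℝ} {j : ℕ} (hθ : 0 < θ) (hs₀ : 0 < s₀) (hC₂ : 0 < C₂)
    (hCR : 0 < CR) (hr : 0 < r) (hrate : r ≤ C₂ * θ ^ j) (hj : θ ^ j < s₀ / (2 * C₂ * CR)) :
    max 2 (s₀ / (2 * C₂ * CR) / θ ^ j) * CR ≤ s₀ / r := by
  have hθj : 0 < θ ^ j := pow_pos hθ j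
  rw [← le_div_iff₀ hCR, max_le_iff]
  constructor
  · -- the floor `2`: `2·C_R·r ≤ s₀` because `r ≤ C₂θ^j < C₂·s = s₀∕(2C_R)`
    rw [le_div_iff₀ hCR, le_div_iff₀ hr]
    have h1 : r < s₀ / (2 * CR) :=
      calc r ≤ C₂ * θ ^ j := hrate
        _ < C₂ * (s₀ / (2 * C₂ * CR)) := by gcongr
        _ = s₀ / (2 * CR) := by field_simp
    have h2 := (lt_div_iff₀ (by positivity)).1 h1
    linarith
  · -- the window term: `(s∕θ^j)·C_R·r = (s₀∕2)·(r∕(C₂θ^j)) ≤ s₀∕2 ≤ s₀`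
    rw [le_div_iff₀ hCR, le_div_iff₀ hr]
    have h3 : r / (C₂ * θ ^ j) ≤ 1 := (div_le_one (by positivity)).2 hrate
    calc s₀ / (2 * C₂ * CR) / θ ^ j * CR * r = s₀ / 2 * (r / (C₂ * θ ^ j)) := by
          field_simp
      _ ≤ s₀ / 2 * 1 := by gcongr
      _ ≤ s₀ := by linarith

/-- The σ-distance side of the junction (the END's `(w j).Rσ = max R_σ0 C_σ` against [Balaban1988RG2Cluster] p. 13's
`R_σ ≤ ⅔M`): a bond-cube side `M ≥ (3∕2)·max R_σ0 C_σ` suffices. [folklore] -/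
theorem sigma_distance_le_of_side {Rσ₀ Cσ M : ℝ} (hM : 3 / 2 * max Rσ₀ Cσ ≤ M) : max Rσ₀ Cσ ≤ 2 / 3 * M := by
  linarith

/-! ## §3 N18 in the K4 family shape at the torus carriers of record, in the rate currency -/

variable {L : ℕ} [NeZero L]

open Classical in
/-- **§3a — N18 BY NAME, K4 FAMILY SHAPE, RATE CURRENCY.**  Carriers: the scale-indexed torus models `W j` (NODE 00's
objects in the NE5 chain's reading), run A's outputs `E₀ j`, run B's outputs `E₁ b j` for every member `b` of its
first-coupling family.  In-edges as binders: (N10 ∕ NODE A) the one-run envelopes `hA1`, `hB1` ([II] (2.41) per run);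
(N15 ∕ N16) the primitive two-run rate `r_j ≤ C₂θ^j`, `hrate`; (NODE O) per member, at every WINDOW scale
`θ^j < s₀∕C₂`, the two-run bound with pencil radius `s₀∕r_j`, `hE` (the Schwarz output of T14 at that radius).
Conclusion: `∀ b ∈ ]0, γ], NE5 (reFunctional E₀) (reFunctional (E₁ b)) W′ κ′ θ (2AC₂∕s₀)` for every coupling window —
the NE5 rate is the rate `θ` INHERITED from rows NE2∕NE3, the constant is `2A·C₂∕s₀`; at the early scales the one-run
envelopes give the same constant (T16 `ne5_of_torus_rates_all_scales`). [cite: Balaban1987RG1, (1.18) p.263; Balaban1988RG2Cluster, (2.41) p.21; King1986, Thm 3.4 (3.9) p.656, p.665] -/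
theorem ne5_family_of_primitive_rate (N : ℕ → ℕ) [∀ j, NeZero (N j)] (W : (j : ℕ) → TwoTorusStep 4 L (N j))
    (γ : ℝ) (E₀ : (j : ℕ) → TDom 4 (N j) → (W j).Φ → ℂ) (E₁ : ℝ → (j : ℕ) → TDom 4 (N j) → (W j).Φ → ℂ)
    {A κ' θ C₂ s₀ : ℝ} {r : ℕ → ℝ} (hA : 0 ≤ A) (hθ : 0 < θ) (hC₂ : 0 < C₂) (hs₀ : 0 < s₀)
    (hr : ∀ j, 0 < r j) (hrate : ∀ j, r j ≤ C₂ * θ ^ j)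
    (hA1 : ∀ (j : ℕ) (X : TDom 4 (N j)) (φ : (W j).Φ), φ ∈ (W j).sp2 X →
      ‖E₀ j X φ‖ ≤ A * Real.exp (-(κ' * (tsys 4 (N j)).dj X)))
    (hB1 : ∀ b : ℝ, 0 < b → b ≤ γ → ∀ (j : ℕ) (X : TDom 4 (N j)) (φ : (W j).Φ), φ ∈ (W j).sp2 X →
      ‖E₁ b j X φ‖ ≤ A * Real.exp (-(κ' * (tsys 4 (N j)).dj X)))
    (hE : ∀ b : ℝ, 0 < b → b ≤ γ → ∀ (j : ℕ), θ ^ j < s₀ / C₂ → ∀ (X : TDom 4 (N j)) (φ : (W j).Φ),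
      φ ∈ (W j).sp2 X →
      ‖E₁ b j X φ - E₀ j X φ‖ ≤ 2 * (A * Real.exp (-(κ' * (tsys 4 (N j)).dj X))) / (s₀ / r j))
    (W' : Set (ℕ → ℝ)) :
    ∀ b : ℝ, 0 < b → b ≤ γ →
      NE5 (C := torusCarriers N W) (reFunctional N W E₀) (reFunctional N W (E₁ b)) W' κ' θ (2 * A * C₂ / s₀) := by
  intro b hb hbγ
  have hs : 0 < s₀ / C₂ := div_pos hs₀ hC₂
  have key : ∀ (j : ℕ), θ ^ j < s₀ / C₂ → ∀ (X : TDom 4 (N j)) (φ : (W j).Φ), φ ∈ (W j).sp2 X →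
      ‖E₁ b j X φ - E₀ j X φ‖ ≤ 2 * (A * Real.exp (-(κ' * (tsys 4 (N j)).dj X))) / (s₀ / C₂ / θ ^ j) := by
    intro j hj X φ hφ
    have hθj : 0 < θ ^ j := pow_pos hθ j
    have hAe : 0 ≤ A * Real.exp (-(κ' * (tsys 4 (N j)).dj X)) := mul_nonneg hA (Real.exp_pos _).le
    -- pencil radius `s₀∕r_j ≥ s₀∕(C₂θ^j) = (s₀∕C₂)∕θ^j`: the rate is inherited
    have hρ : s₀ / C₂ / θ ^ j ≤ s₀ / r j := by
      rw [div_div]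
      exact div_le_div_of_nonneg_left hs₀.le (hr j) (hrate j)
    calc ‖E₁ b j X φ - E₀ j X φ‖ ≤ 2 * (A * Real.exp (-(κ' * (tsys 4 (N j)).dj X))) / (s₀ / r j) :=
          hE b hb hbγ j hj X φ hφ
      _ ≤ 2 * (A * Real.exp (-(κ' * (tsys 4 (N j)).dj X))) / (s₀ / C₂ / θ ^ j) :=
          div_le_div_of_nonneg_left (by positivity) (by positivity) hρ
  have h := ne5_of_torus_rates_all_scales N W E₀ (E₁ b) hA hθ hs hA1 (hB1 b hb hbγ) key W'
  have hc : 2 * A / (s₀ / C₂) = 2 * A * C₂ / s₀ := by field_simp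
  rw [hc] at h
  exact h

open Classical in
/-- **§3b — THE SAME FROM THE HOLOMORPHIC OUTPUT PENCILS** (NODE O's interface one level up, the Schwarz step inside).
Per member `b`, per WINDOW scale `θ^j < s₀∕C₂` and per domain, an output pencil `P b j · X φ : ℂ → ℂ` joining run A's
output (`P b j 0 X φ = E₀ j X φ`) to run B's (`P b j 1 X φ = E₁ b j X φ`), holomorphic on the ball of radius `s₀∕r_j`
with the one-run envelope along it (what T25–T29 of the NE5 chain deliver from per-term walk records, at the radius
T42 affords from `r_j`-close runs); with the rate `r_j ≤ C₂θ^j` the radius exceeds `1` at the window scales and T14's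
Schwarz step `norm_sub_le_of_pencil` gives §3a's two-run bound.  Conclusion as in §3a.
[cite: Balaban1987RG1, (1.18) p.263; Balaban1988RG2Cluster, (2.41) p.21; King1986, Thm 3.4 (3.9) p.656, p.665] -/
theorem ne5_family_of_primitive_rate_pencils (N : ℕ → ℕ) [∀ j, NeZero (N j)]
    (W : (j : ℕ) → TwoTorusStep 4 L (N j)) (γ : ℝ)
    (E₀ : (j : ℕ) → TDom 4 (N j) → (W j).Φ → ℂ) (E₁ : ℝ → (j : ℕ) → TDom 4 (N j) → (W j).Φ → ℂ)
    (P : ℝ → (j : ℕ) → ℂ → TDom 4 (N j) → (W j).Φ → ℂ)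
    {A κ' θ C₂ s₀ : ℝ} {r : ℕ → ℝ} (hA : 0 ≤ A) (hθ : 0 < θ) (hC₂ : 0 < C₂) (hs₀ : 0 < s₀)
    (hr : ∀ j, 0 < r j) (hrate : ∀ j, r j ≤ C₂ * θ ^ j)
    (hA1 : ∀ (j : ℕ) (X : TDom 4 (N j)) (φ : (W j).Φ), φ ∈ (W j).sp2 X →
      ‖E₀ j X φ‖ ≤ A * Real.exp (-(κ' * (tsys 4 (N j)).dj X)))
    (hB1 : ∀ b : ℝ, 0 < b → b ≤ γ → ∀ (j : ℕ) (X : TDom 4 (N j)) (φ : (W j).Φ), φ ∈ (W j).sp2 X →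
      ‖E₁ b j X φ‖ ≤ A * Real.exp (-(κ' * (tsys 4 (N j)).dj X)))
    (hP0 : ∀ b : ℝ, 0 < b → b ≤ γ → ∀ (j : ℕ), θ ^ j < s₀ / C₂ → ∀ (X : TDom 4 (N j)) (φ : (W j).Φ),
      φ ∈ (W j).sp2 X → P b j 0 X φ = E₀ j X φ)
    (hP1 : ∀ b : ℝ, 0 < b → b ≤ γ → ∀ (j : ℕ), θ ^ j < s₀ / C₂ → ∀ (X : TDom 4 (N j)) (φ : (W j).Φ),
      φ ∈ (W j).sp2 X → P b j 1 X φ = E₁ b j X φ)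
    (hpencil : ∀ b : ℝ, 0 < b → b ≤ γ → ∀ (j : ℕ), θ ^ j < s₀ / C₂ → ∀ (X : TDom 4 (N j)) (φ : (W j).Φ),
      φ ∈ (W j).sp2 X →
      DifferentiableOn ℂ (fun z => P b j z X φ) (ball (0 : ℂ) (s₀ / r j)) ∧
        ∀ z ∈ ball (0 : ℂ) (s₀ / r j), ‖P b j z X φ‖ ≤ A * Real.exp (-(κ' * (tsys 4 (N j)).dj X)))
    (W' : Set (ℕ → ℝ)) :
    ∀ b : ℝ, 0 < b → b ≤ γ →
      NE5 (C := torusCarriers N W) (reFunctional N W E₀) (reFunctional N W (E₁ b)) W' κ' θ (2 * A * C₂ / s₀) := by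
  refine ne5_family_of_primitive_rate N W γ E₀ E₁ hA hθ hC₂ hs₀ hr hrate hA1 hB1 (fun b hb hbγ j hj X φ hφ => ?_) W'
  -- at a window scale the pencil radius `s₀∕r_j ≥ s₀∕(C₂θ^j) > 1`: Schwarz
  have hθj : 0 < θ ^ j := pow_pos hθ j
  have hρ1 : 1 < s₀ / r j := by
    have h1 : 1 < s₀ / C₂ / θ ^ j := (one_lt_div hθj).2 hj
    have h2 : s₀ / C₂ / θ ^ j ≤ s₀ / r j := by
      rw [div_div]
      exact div_le_div_of_nonneg_left hs₀.le (hr j) (hrate j)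
    exact lt_of_lt_of_le h1 h2
  obtain ⟨hhol, hbd⟩ := hpencil b hb hbγ j hj X φ hφ
  have h := norm_sub_le_of_pencil hρ1 hhol hbd
  rw [hP0 b hb hbγ j hj X φ hφ, hP1 b hb hbγ j hj X φ hφ] at h
  exact h

/-! ## §4 (v1.1) Transfer of the node statement along a map of carriers

Recorded for NODE 00's later-stage record predicate (companion `BalabanUVNodesN18Coherence` §1: at `torusCarriers` the
gauge is `0` and the transport is `id`, so N19's argument bracket cannot live there): ANY refinement `C′` of the carriers —
e.g. one with a genuine closeness gauge and block-averaging transport — that maps to `C` preserving creation scale and tree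
length and commuting with the transports INHERITS `NE5` for the pulled-back functionals, with the same letters.  So the U3
carriers of record may carry N19's gauge while N18 is still read off the NE5 chain's END on `torusCarriers`. -/

/-- **`NE5` pulls back along a map of carriers** preserving `scale` and `d` and commuting with the transports: the
pulled-back functionals `(g, U, X) ↦ EA g (φA U) (φD X)`, `(g, U, X) ↦ EB g (φB U) (φD X)` satisfy `NE5` on `C′` with the
same window and letters. [folklore] -/
theorem ne5_comap {C C' : Carriers} (φD : C'.Dom → C.Dom) (φA : C'.BgA → C.BgA) (φB : C'.BgB → C.BgB)
    (hscale : ∀ X, C.scale (φD X) = C'.scale X) (hd : ∀ X, C.d (φD X) = C'.d X)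
    (htr : ∀ U, φA (C'.transport U) = C.transport (φB U))
    {EA : Functional C C.BgA} {EB : Functional C C.BgB} {W : Set (ℕ → ℝ)} {κ θ C₅ : ℝ}
    (h : NE5 EA EB W κ θ C₅) :
    NE5 (C := C') (fun g U X => EA g (φA U) (φD X)) (fun g U X => EB g (φB U) (φD X)) W κ θ C₅ := by
  intro g hg U X
  show |EA g (φA (C'.transport U)) (φD X) - EB g (φB U) (φD X)| ≤ C₅ * θ ^ C'.scale X * Real.exp (-(κ * C'.d X))
  rw [htr, ← hscale, ← hd]
  exact h g hg (φB U) (φD X)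

/-- The same with the tree length allowed to SHRINK along the map (`C′.d X ≤ C.d (φD X)`, e.g. a coarser length on the
refined carriers) when `0 ≤ κ`, `0 ≤ θ`, `0 ≤ C₅`. [folklore] -/
theorem ne5_comap_of_le {C C' : Carriers} (φD : C'.Dom → C.Dom) (φA : C'.BgA → C.BgA) (φB : C'.BgB → C.BgB)
    (hscale : ∀ X, C.scale (φD X) = C'.scale X) (hd : ∀ X, C'.d X ≤ C.d (φD X))
    (htr : ∀ U, φA (C'.transport U) = C.transport (φB U))
    {EA : Functional C C.BgA} {EB : Functional C C.BgB} {W : Set (ℕ → ℝ)} {κ θ C₅ : ℝ} (hκ : 0 ≤ κ) (hθ : 0 ≤ θ)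
    (hC₅ : 0 ≤ C₅) (h : NE5 EA EB W κ θ C₅) :
    NE5 (C := C') (fun g U X => EA g (φA U) (φD X)) (fun g U X => EB g (φB U) (φD X)) W κ θ C₅ := by
  intro g hg U X
  show |EA g (φA (C'.transport U)) (φD X) - EB g (φB U) (φD X)| ≤ C₅ * θ ^ C'.scale X * Real.exp (-(κ * C'.d X))
  rw [htr, ← hscale]
  have h0 := h g hg (φB U) (φD X)
  have he : Real.exp (-(κ * C.d (φD X))) ≤ Real.exp (-(κ * C'.d X)) :=
    Real.exp_le_exp.2 (by nlinarith [hd X])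
  exact h0.trans (mul_le_mul_of_nonneg_left he (mul_nonneg hC₅ (pow_nonneg hθ _)))

/-- The K4 family shape transfers the same way. [folklore] -/
theorem ne5_family_comap {C C' : Carriers} (φD : C'.Dom → C.Dom) (φA : C'.BgA → C.BgA) (φB : C'.BgB → C.BgB)
    (hscale : ∀ X, C.scale (φD X) = C'.scale X) (hd : ∀ X, C.d (φD X) = C'.d X)
    (htr : ∀ U, φA (C'.transport U) = C.transport (φB U))
    {EA : Functional C C.BgA} {EB : ℝ → Functional C C.BgB} {W : Set (ℕ → ℝ)} {κ θ C₅ γ : ℝ}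
    (h : ∀ b : ℝ, 0 < b → b ≤ γ → NE5 EA (EB b) W κ θ C₅) :
    ∀ b : ℝ, 0 < b → b ≤ γ →
      NE5 (C := C') (fun g U X => EA g (φA U) (φD X)) (fun g U X => EB b g (φB U) (φD X)) W κ θ C₅ :=
  fun b hb hbγ => ne5_comap φD φA φB hscale hd htr (h b hb hbγ)

end Summit.QuantumFields.YangMills.BalabanUVNodes.N18Knit

end
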